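import Summits.BirchSwinnertonDyer.Rank1Residual.O5.FlexNFCaseSKodairaLawThreeProofs
import HarnessLib

/-!
# T30.4 Case N of the flex normal form at `3` — the CELLS with `v₃Δ ≤ 6`: `y² + 3b·xy + A₃y = x³`
# (`A₃ ≡ 1 (mod 3)`) has, on the translate `nfT` (`(u,r,s,t) = (1,−1,0,1)`, the cusp of the reduction moved
# to the origin), Kodaira type `II` (`9 ∤ u`, `u := A₃ − 3b + 2`; `v₃Δ_min = 3` or `4`), `III` (`9 ∣ u`,
# `b ≢ 1 (mod 3)`; `v₃Δ_min = 3`), `IV` (`b ≡ 1 (mod 3)`, `A₃ ≡ 1 (mod 9)`, `9 ∥ b³ − A₃`; `v₃Δ_min = 5`),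
# `I₀*` (`27 ∥ b³ − A₃`; `v₃Δ_min = 6`) — Tate's algorithm Steps 1–6 in the kernel
# (cell `b2b-bsdres`, team n1011, ROW T-FLEX-KOD FILE 3a; seat `b2b-bsdres-n1011-p18` GEN 13 (bank) / GEN 14
#  (filing, idle rule, for T29.6 `FlexNFTypeIIIFlatUnitThree` `_holds` = FILE 3c `FlexNFTypeIIIFlatUnitThreeProofs`);
#  theorems only; the `Iₙ*` tail `v₃(b³ − A₃) ≥ 4` with the TRUE valuation is the tree's `FlexNFCaseNTailThree`)

HONEST FRAMING (cell `b2b-bsdres`, run/shared/lean/b2b/bsd-rank1-residual/, verbatim in every file): the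
goal of the cell is to DELETE the COMBINATION-SHAPED residual classes of the Birch–Swinnerton-Dyer formula
for ALL analytic-rank `≤ 1` elliptic curves over `ℚ` — "full BSD formula for every rank `≤ 1` curve in
class `C`" assembled STRICTLY from published theorems — so that the rank-`≤ 1` remainder becomes exactly
the CONSTRUCTION-SHAPED classes, which are TYPED (missing-input `Prop`s), NOT attempted. This is not
"finishing BSD". Lane CLASS-CLOSURE / O5 (O5 OPEN): research route; census output (P-K19) is EVIDENCE,
never a Literature fact; nothing is booked; no mark of `RESIDUAL-MAP.md` moves. This file: THEOREMS ONLY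
(no definition, no named fact, no `@[conjecture]` node, no `sorry`; net named-fact debt `0`); nothing of
cc-typer-5's / o5-r1's files is edited.  These cells hold for EVERY `(b, A₃)` in their residue classes: they
are the `v₃Δ ≤ 6` half of T30.4 read with the true valuation (the typed node `FlexNFCaseNKodairaLawThree` is
false only through its fuel-capped `ord3 64`, `not_flexNFCaseNKodairaLawThree`); the v2 VAL-law `_holds`
(cc-typer-5 (c28)) and T29.6 (FILE 3c) both assemble from this file + the tail.

## What is proved (at `Additive.placeOf 3`, for `nfQ b A₃ 0 = y² + 3b·xy + A₃y − x³` over `ℚ`)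
* §1 `nfQ_zero_eq_baseChange` (integer model `nf (3b) A₃`), `nfT_int_eqs` (coefficients, `b₂, b₆, b₈`,
  `Δ = 27A₃³(b³ − A₃)` of the integer translate `nfT`), small `3`-adic bookkeeping;
* §2 `kodairaSymbolAt_and_ord_nfQ_zero_of_nfT`: FILE 1's engine
  `kodairaSymbolAt_and_ordMinimalDiscriminant_placeOf_three_of_intModel` specialised to the change `(1,−1,0,1)`
  (minimality from `v₃Δ < 12`);
* §3 the cells `kodairaSymbolAt_and_ord_nfQ_zero_II` (`9 ∤ u`, `3ᵐ ∥ b³ − A₃`, `m ≤ 1` ⟹ `II`, `m + 3`),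
  `…_III` (`9 ∣ u`, `b ≢ 1` ⟹ `III`, `3`), `…_IV` (`b ≡ 1`, `9 ∥ b³ − A₃` ⟹ `IV`, `5`),
  `…_Istar_zero` (`b ≡ 1`, `27 ∥ b³ − A₃` ⟹ `I₀*`, `6`; Step 6: the cubic `T³ − T² − kT − r` has
  discriminant `≡ g ≢ 0 (mod 3)`, `b = 3k + 1`, `b³ − A₃ = 27g`).
[cite: SilvermanATAEC1994, IV.9.4 (Tate's algorithm) Steps 1–6]
-/

open scoped NumberField

open IsDedekindDomain Rat.HeightOneSpectrum WeierstrassCurve NumberField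
  Literature.NumberTheory.EllipticCurves Literature.NumberTheory.DiophantineGeometry
  Literature.NumberTheory.DiophantineGeometry.TateAlgorithm
  Summit.BirchSwinnertonDyer.BirchSwinnertonDyer.Rank2Observatory.Tate
  Summit.BirchSwinnertonDyer.Rank1Residual

namespace Summit.BirchSwinnertonDyer.Rank1Residual.O5.FlexNormalForm

/-! ## §1 The integer translate `nfT` and small `3`-adic bookkeeping -/

/-- `nfQ b A₃ 0` is the base change of the INTEGER flex model `nf (3b) A₃`. [folklore] -/
theorem nfQ_zero_eq_baseChange (b A₃ : ℤ) :
    nfQ b A₃ 0 = (nf (3 * b) A₃ : WeierstrassCurve ℤ).baseChange ℚ := by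
  ext <;> simp [nfQ, nf, WeierstrassCurve.baseChange, WeierstrassCurve.map]

/-- The coefficients, `b₂`, `b₆`, `b₈` and `Δ` of the integer translate
`nfT b A₃ = (1,−1,0,1) • nf (3b) A₃ = [3b, −3, u, 3(1 − b), −u]`, `u = A₃ − 3b + 2`. [folklore] -/
theorem nfT_int_eqs (b A₃ : ℤ) :
    (nfT b A₃ : WeierstrassCurve ℤ).a₁ = 3 * b ∧ (nfT b A₃ : WeierstrassCurve ℤ).a₂ = -3 ∧
    (nfT b A₃ : WeierstrassCurve ℤ).a₃ = A₃ - 3 * b + 2 ∧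
    (nfT b A₃ : WeierstrassCurve ℤ).a₄ = 3 * (1 - b) ∧
    (nfT b A₃ : WeierstrassCurve ℤ).a₆ = -(A₃ - 3 * b + 2) ∧
    (nfT b A₃ : WeierstrassCurve ℤ).b₂ = 3 * (3 * b ^ 2 - 4) ∧
    (nfT b A₃ : WeierstrassCurve ℤ).b₆ = (A₃ - 3 * b + 2) * ((A₃ - 3 * b + 2) - 4) ∧
    (nfT b A₃ : WeierstrassCurve ℤ).b₈ =
      (A₃ - 3 * b + 2) * (12 - 9 * b) - 3 * (A₃ - 3 * b + 2) ^ 2 - 9 * (1 - b) ^ 2 ∧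
    (nfT b A₃ : WeierstrassCurve ℤ).Δ = 27 * A₃ ^ 3 * (b ^ 3 - A₃) :=
  ⟨rfl, rfl, rfl, rfl, rfl, nfT_b₂ b A₃, nfT_b₆ b A₃, nfT_b₈ b A₃, nfT_Δ b A₃⟩

/-- `A₃ ≡ 1 (mod 3) ⟹ 3 ∤ A₃`. [folklore] -/
private theorem not_three_dvd_of_emod_one {A₃ : ℤ} (hA : A₃ % 3 = 1) : ¬ (3 : ℤ) ∣ A₃ := by
  intro h; have := (Int.dvd_iff_emod_eq_zero ..).mp h; omega

/-- If `3 ∤ u` then `3ⁿ⁺¹ ∤ 3ⁿ·u`. [folklore] -/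
private theorem not_pow_succ_dvd_pow_mul₁ {u : ℤ} (n : ℕ) (hu : ¬ (3 : ℤ) ∣ u) :
    ¬ (3 : ℤ) ^ (n + 1) ∣ 3 ^ n * u := by
  rintro ⟨k, hk⟩
  refine hu ⟨k, ?_⟩
  have h3 : (3 : ℤ) ^ n ≠ 0 := pow_ne_zero _ (by norm_num)
  apply mul_left_cancel₀ h3
  rw [hk, pow_succ]; ring

/-- `3 ∤ x, 3 ∤ y ⟹ 3 ∤ x·y`. [folklore] -/
private theorem not_three_dvd_mul₁ {x y : ℤ} (hx : ¬ (3 : ℤ) ∣ x) (hy : ¬ (3 : ℤ) ∣ y) :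
    ¬ (3 : ℤ) ∣ x * y :=
  fun h ↦ (Int.prime_three.dvd_or_dvd h).elim hx hy

/-- `3 ∤ x ⟹ 3 ∤ xⁿ`. [folklore] -/
private theorem not_three_dvd_pow₁ {x : ℤ} (hx : ¬ (3 : ℤ) ∣ x) (n : ℕ) : ¬ (3 : ℤ) ∣ x ^ n :=
  fun h ↦ hx (Int.prime_three.dvd_of_dvd_pow h)

/-- `(3 : ℕ)ᵏ ∣ 3ᵏ·x` in `ℤ`. [folklore] -/
private theorem natCast_pow_dvd_mul₁ (k : ℕ) (x : ℤ) : ((3 : ℕ) : ℤ) ^ k ∣ 3 ^ k * x := by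
  push_cast; exact dvd_mul_right _ _

/-- `3ⁿ ∥ A₃³·M` when `3 ∤ A₃`, `3 ∤ M`, for `Δ(nfT) = 27A₃³(b³ − A₃) = 3ⁿ⁺³·(A₃³M)`-type bookkeeping:
the exact power of `3` in `3ᵏ · (A₃³ · M)`. [folklore] -/
private theorem pexact_of_units {A₃ M : ℤ} (k : ℕ) (hA : ¬ (3 : ℤ) ∣ A₃) (hM : ¬ (3 : ℤ) ∣ M) :
    (3 : ℤ) ^ k ∣ 3 ^ k * (A₃ ^ 3 * M) ∧ ¬ (3 : ℤ) ^ (k + 1) ∣ 3 ^ k * (A₃ ^ 3 * M) :=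
  ⟨dvd_mul_right _ _, not_pow_succ_dvd_pow_mul₁ _ (not_three_dvd_mul₁ (not_three_dvd_pow₁ hA 3) hM)⟩

/-! ## §2 The engine call on the translate -/

/-- **Tate's algorithm on the translate `nfT b A₃`, read at `placeOf 3` for `nfQ b A₃ 0`**: if
`3ⁿ ∥ Δ(nfT b A₃)` with `n < 12` and the literal algorithm returns `T` on the cast of `nfT b A₃` in every
presentation `3 = ϖε`, then `nfQ b A₃ 0` has Kodaira type `T` and `ord₃Δ_min = n` (FILE 1's engine with the
integer change `(1,−1,0,1)`, `smul_nf_eq_nfT`). [cite: SilvermanATAEC1994, IV.9.4] -/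
theorem kodairaSymbolAt_and_ord_nfQ_zero_of_nfT (b A₃ : ℤ) {n : ℕ} (hn : n < 12)
    (hΔ : (3 : ℤ) ^ n ∣ (nfT b A₃ : WeierstrassCurve ℤ).Δ)
    (hΔ' : ¬ (3 : ℤ) ^ (n + 1) ∣ (nfT b A₃ : WeierstrassCurve ℤ).Δ) {T : KodairaSymbol}
    (hT : ∀ (v' : HeightOneSpectrum (𝓞 ℚ)) (ε : v'.adicCompletionIntegers ℚ), IsUnit ε →
      ((3 : ℕ) : v'.adicCompletionIntegers ℚ) = uniformizer (v'.adicCompletionIntegers ℚ) * ε →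
      ((nfT b A₃ : WeierstrassCurve ℤ).map
        (Int.castRingHom (v'.adicCompletionIntegers ℚ))).kodairaSymbolOfMinimal = T) :
    (nfQ b A₃ 0).kodairaSymbolAt (Additive.placeOf 3) = T ∧
      (nfQ b A₃ 0).ordMinimalDiscriminant (Additive.placeOf 3) = n := by
  rw [nfQ_zero_eq_baseChange]
  exact kodairaSymbolAt_and_ordMinimalDiscriminant_placeOf_three_of_intModel (nf (3 * b) A₃) (nfT b A₃)
    ⟨1, -1, 0, 1⟩ rfl (smul_nf_eq_nfT b A₃).symm
    (fun v' hv' ↦ isMinimalAt_of_criterion v' hv' _ (by exact_mod_cast hΔ) (by exact_mod_cast hΔ')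
      (Or.inl hn)) hΔ hΔ' hT

/-! ## §3 The cells `II` (v₃Δ = 3, 4), `III`, `IV`, `I₀*` -/

/-- **Cell `II`: `9 ∤ u = A₃ − 3b + 2` and `3ⁿ⁻³ ∥ b³ − A₃` (`n ∈ {3, 4}`) ⟹ type `II`, `ord₃Δ_min = n`**
(Steps 1–3 on the translate: `3 ∣ a₃, a₄, a₆, b₂`, `9 ∤ a₆ = −u`).
[cite: SilvermanATAEC1994, IV.9.4 Steps 1–3] -/
theorem kodairaSymbolAt_and_ord_nfQ_zero_II (b A₃ : ℤ) (hA : A₃ % 3 = 1)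
    (hu : ¬ (9 : ℤ) ∣ A₃ - 3 * b + 2) {m : ℕ} (hm : m ≤ 1)
    (hM : (3 : ℤ) ^ m ∣ b ^ 3 - A₃) (hM' : ¬ (3 : ℤ) ^ (m + 1) ∣ b ^ 3 - A₃) :
    (nfQ b A₃ 0).kodairaSymbolAt (Additive.placeOf 3) = .II ∧
      (nfQ b A₃ 0).ordMinimalDiscriminant (Additive.placeOf 3) = m + 3 := by
  have hA3 := not_three_dvd_of_emod_one hA
  obtain ⟨e1, e2, e3, e4, e6, eb₂, eb₆, eb₈, eΔ⟩ := nfT_int_eqs b A₃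
  obtain ⟨M, hMM⟩ := hM
  have hMu : ¬ (3 : ℤ) ∣ M := fun ⟨k, hk⟩ ↦ hM' ⟨k, by rw [hMM, hk, pow_succ]; ring⟩
  have eΔ' : (nfT b A₃ : WeierstrassCurve ℤ).Δ = 3 ^ (m + 3) * (A₃ ^ 3 * M) := by
    rw [eΔ, hMM]; ring
  obtain ⟨hΔ, hΔ'⟩ := pexact_of_units (m + 3) hA3 hMu
  rw [← eΔ'] at hΔ hΔ'
  have hu3 : (3 : ℤ) ∣ A₃ - 3 * b + 2 := by omega
  refine kodairaSymbolAt_and_ord_nfQ_zero_of_nfT b A₃ (n := m + 3) (by omega) hΔ hΔ' ?_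
  intro v' ε hε hpε
  haveI := perfectField_residueField_adicCompletionIntegers (K := ℚ) v'
  obtain ⟨f1, f2, f3, f4, f6, fΔ⟩ := map_intCast_eqs (R := v'.adicCompletionIntegers ℚ)
    (nfT b A₃ : WeierstrassCurve ℤ)
  refine kodairaSymbolOfMinimal_eq_II_of_step2 ?_ ?_ ?_ ?_ ?_ ?_
  · rw [fΔ]; exact uniformizer_dvd_intCast hpε ((pow_dvd_pow (3 : ℤ) (by omega : 1 ≤ m + 3)).trans hΔ)
  · rw [f3, e3]; exact uniformizer_dvd_intCast hpε (by rw [pow_one]; exact_mod_cast hu3)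
  · rw [f4, e4]; exact uniformizer_dvd_intCast hpε (by rw [pow_one]; exact_mod_cast dvd_mul_right (3:ℤ) _)
  · rw [f6, e6]; exact uniformizer_dvd_intCast hpε (by rw [pow_one]; exact_mod_cast (dvd_neg.mpr hu3))
  · rw [WeierstrassCurve.map_b₂, eb₂, eq_intCast]
    exact uniformizer_dvd_intCast hpε (by rw [pow_one]; exact_mod_cast dvd_mul_right (3:ℤ) _)
  · rw [f6, e6]
    refine not_pow_succ_dvd_intCast Nat.prime_three hε hpε (n := 1)
      (by rw [pow_one]; exact_mod_cast (dvd_neg.mpr hu3)) ?_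
    push_cast
    rw [dvd_neg]; exact hu

/-- **Cell `III`: `9 ∣ u`, `b ≢ 1 (mod 3)` ⟹ type `III`, `ord₃Δ_min = 3`** (Steps 1–4 on the translate:
`9 ∣ a₆ = −u`, `27 ∤ b₈ ≡ −9(1 − b)² (mod 27)`). [cite: SilvermanATAEC1994, IV.9.4 Steps 1–4] -/
theorem kodairaSymbolAt_and_ord_nfQ_zero_III (b A₃ : ℤ) (hA : A₃ % 3 = 1) (hb : b % 3 ≠ 1)
    (hu : (9 : ℤ) ∣ A₃ - 3 * b + 2) :
    (nfQ b A₃ 0).kodairaSymbolAt (Additive.placeOf 3) = .III ∧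
      (nfQ b A₃ 0).ordMinimalDiscriminant (Additive.placeOf 3) = 3 := by
  have hA3 := not_three_dvd_of_emod_one hA
  obtain ⟨e1, e2, e3, e4, e6, eb₂, eb₆, eb₈, eΔ⟩ := nfT_int_eqs b A₃
  obtain ⟨q, hq⟩ := hu
  -- `b = 3k` or `b = 3k + 2`; in both cases `3 ∤ b³ − A₃` and `(1 − b)² = 3·(…) + 1`
  have hb' : b % 3 = 0 ∨ b % 3 = 2 := by omega
  obtain ⟨k, hk⟩ : ∃ k, b = 3 * k + (b % 3) := ⟨b / 3, by omega⟩
  have hMu : ¬ (3 : ℤ) ∣ b ^ 3 - A₃ := by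
    rcases hb' with h0 | h2
    · rw [h0] at hk
      intro h
      have e : b ^ 3 - A₃ = 3 * (9 * k ^ 3) + (-A₃) := by rw [hk]; ring
      rw [e] at h
      have := (Int.dvd_add_right (Dvd.intro _ rfl)).mp h
      exact hA3 (dvd_neg.mp this)
    · rw [h2] at hk
      intro h
      have e : b ^ 3 - A₃ = 3 * (9 * k ^ 3 + 18 * k ^ 2 + 12 * k + 3) + (-A₃ - 1) := by rw [hk]; ring
      rw [e] at h
      have := (Int.dvd_add_right (Dvd.intro _ rfl)).mp h
      omega
  have eΔ' : (nfT b A₃ : WeierstrassCurve ℤ).Δ = 3 ^ 3 * (A₃ ^ 3 * (b ^ 3 - A₃)) := by rw [eΔ]; ring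
  obtain ⟨hΔ, hΔ'⟩ := pexact_of_units 3 hA3 hMu
  rw [← eΔ'] at hΔ hΔ'
  -- `b₈ = 27·X − 9(1 − b)²` and `9(1 − b)² = 27·Y + 9`
  have hb₈ : ¬ (3 : ℤ) ^ (2 + 1) ∣ (nfT b A₃ : WeierstrassCurve ℤ).b₈ := by
    rw [eb₈, hq]
    have e : 9 * q * (12 - 9 * b) - 3 * (9 * q) ^ 2 - 9 * (1 - b) ^ 2 =
        27 * (4 * q - 3 * b * q - 9 * q ^ 2) - 9 * (1 - b) ^ 2 := by ring
    rw [e]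
    rcases hb' with h0 | h2
    · rw [h0] at hk
      have e2 : (27 : ℤ) * (4 * q - 3 * b * q - 9 * q ^ 2) - 9 * (1 - b) ^ 2 =
          27 * (4 * q - 3 * b * q - 9 * q ^ 2 - 3 * k ^ 2 + 2 * k) - 9 := by rw [hk]; ring
      rw [e2]; omega
    · rw [h2] at hk
      have e2 : (27 : ℤ) * (4 * q - 3 * b * q - 9 * q ^ 2) - 9 * (1 - b) ^ 2 =
          27 * (4 * q - 3 * b * q - 9 * q ^ 2 - 3 * k ^ 2 - 2 * k) - 9 := by rw [hk]; ring
      rw [e2]; omega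
  have hb₈' : (3 : ℤ) ^ 2 ∣ (nfT b A₃ : WeierstrassCurve ℤ).b₈ := by
    rw [eb₈, hq]; exact ⟨q * (12 - 9 * b) - 27 * q ^ 2 - (1 - b) ^ 2, by ring⟩
  refine kodairaSymbolAt_and_ord_nfQ_zero_of_nfT b A₃ (n := 3) (by norm_num) hΔ hΔ' ?_
  intro v' ε hε hpε
  haveI := perfectField_residueField_adicCompletionIntegers (K := ℚ) v'
  obtain ⟨f1, f2, f3, f4, f6, fΔ⟩ := map_intCast_eqs (R := v'.adicCompletionIntegers ℚ)
    (nfT b A₃ : WeierstrassCurve ℤ)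
  refine kodairaSymbolOfMinimal_eq_III_of_step2 ?_ ?_ ?_ ?_ ?_ ?_ ?_
  · rw [fΔ]; exact uniformizer_dvd_intCast hpε ((pow_dvd_pow (3 : ℤ) (by norm_num : 1 ≤ 3)).trans hΔ)
  · rw [f3, e3, hq]; exact uniformizer_dvd_intCast hpε ⟨3 * q, by push_cast; ring⟩
  · rw [f4, e4]; exact uniformizer_dvd_intCast hpε (by rw [pow_one]; exact_mod_cast dvd_mul_right (3:ℤ) _)
  · rw [f6, e6, hq]; exact uniformizer_dvd_intCast hpε ⟨-(3 * q), by push_cast; ring⟩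
  · rw [WeierstrassCurve.map_b₂, eb₂, eq_intCast]
    exact uniformizer_dvd_intCast hpε (by rw [pow_one]; exact_mod_cast dvd_mul_right (3:ℤ) _)
  · rw [f6, e6, hq]; exact uniformizer_pow_dvd_intCast hpε ⟨-q, by push_cast; ring⟩
  · rw [WeierstrassCurve.map_b₈, eq_intCast]
    exact not_pow_succ_dvd_intCast Nat.prime_three hε hpε (n := 2) (by exact_mod_cast hb₈')
      (by exact_mod_cast hb₈)

/-- **Cell `IV`: `b ≡ 1 (mod 3)`, `A₃ ≡ 1 (mod 9)`, `9 ∥ b³ − A₃` ⟹ type `IV`, `ord₃Δ_min = 5`** (Steps 1–5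
on the translate: with `b = 3k + 1`, `u = 27k²(k + 1) − (b³ − A₃)` has `9 ∥ u`; `27 ∣ b₈`,
`27 ∤ b₆ = u(u − 4)`). [cite: SilvermanATAEC1994, IV.9.4 Steps 1–5] -/
theorem kodairaSymbolAt_and_ord_nfQ_zero_IV (b A₃ : ℤ) (hA : A₃ % 3 = 1) (hb : b % 3 = 1)
    (hM : (3 : ℤ) ^ 2 ∣ b ^ 3 - A₃) (hM' : ¬ (3 : ℤ) ^ (2 + 1) ∣ b ^ 3 - A₃) :
    (nfQ b A₃ 0).kodairaSymbolAt (Additive.placeOf 3) = .IV ∧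
      (nfQ b A₃ 0).ordMinimalDiscriminant (Additive.placeOf 3) = 5 := by
  have hA3 := not_three_dvd_of_emod_one hA
  obtain ⟨e1, e2, e3, e4, e6, eb₂, eb₆, eb₈, eΔ⟩ := nfT_int_eqs b A₃
  obtain ⟨k, hk⟩ : ∃ k, b = 3 * k + 1 := ⟨b / 3, by omega⟩
  obtain ⟨M, hMM⟩ := hM
  have hMu : ¬ (3 : ℤ) ∣ M := fun ⟨c, hc⟩ ↦ hM' ⟨c, by rw [hMM, hc]; ring⟩
  -- `u = 27k²(k+1) − 9M = 9(3k²(k+1) − M)`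
  have hu : A₃ - 3 * b + 2 = 9 * (3 * k ^ 2 * (k + 1) - M) := by
    have e : A₃ - 3 * b + 2 = (b - 1) ^ 2 * (b + 2) - (b ^ 3 - A₃) := by ring
    rw [e, hMM, hk]; ring
  have hmu : ¬ (3 : ℤ) ∣ 3 * k ^ 2 * (k + 1) - M := by
    intro h
    have : (3 : ℤ) ∣ M := by
      have h3 : (3 : ℤ) ∣ 3 * k ^ 2 * (k + 1) := ⟨k ^ 2 * (k + 1), by ring⟩
      simpa using dvd_sub h3 h
    exact hMu this
  set m := 3 * k ^ 2 * (k + 1) - M with hm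
  have eΔ' : (nfT b A₃ : WeierstrassCurve ℤ).Δ = 3 ^ 5 * (A₃ ^ 3 * M) := by rw [eΔ, hMM]; ring
  obtain ⟨hΔ, hΔ'⟩ := pexact_of_units 5 hA3 hMu
  rw [← eΔ'] at hΔ hΔ'
  have hb₈ : (3 : ℤ) ^ 3 ∣ (nfT b A₃ : WeierstrassCurve ℤ).b₈ := by
    rw [eb₈, hu]
    exact ⟨4 * m - 3 * b * m - 9 * m ^ 2 - 3 * k ^ 2, by rw [hk]; ring⟩
  have hb₆ : ¬ (3 : ℤ) ^ (2 + 1) ∣ (nfT b A₃ : WeierstrassCurve ℤ).b₆ := by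
    rw [eb₆, hu]
    have e : 9 * m * (9 * m - 4) = 3 ^ 2 * (m * (9 * m - 4)) := by ring
    rw [e]
    refine not_pow_succ_dvd_pow_mul₁ 2 (not_three_dvd_mul₁ hmu ?_)
    omega
  have hb₆' : (3 : ℤ) ^ 2 ∣ (nfT b A₃ : WeierstrassCurve ℤ).b₆ := by
    rw [eb₆, hu]; exact ⟨m * (9 * m - 4), by ring⟩
  refine kodairaSymbolAt_and_ord_nfQ_zero_of_nfT b A₃ (n := 5) (by norm_num) hΔ hΔ' ?_
  intro v' ε hε hpε
  haveI := perfectField_residueField_adicCompletionIntegers (K := ℚ) v'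
  obtain ⟨f1, f2, f3, f4, f6, fΔ⟩ := map_intCast_eqs (R := v'.adicCompletionIntegers ℚ)
    (nfT b A₃ : WeierstrassCurve ℤ)
  refine kodairaSymbolOfMinimal_eq_IV_of_step2 ?_ ?_ ?_ ?_ ?_ ?_ ?_ ?_
  · rw [fΔ]; exact uniformizer_dvd_intCast hpε ((pow_dvd_pow (3 : ℤ) (by norm_num : 1 ≤ 5)).trans hΔ)
  · rw [f3, e3, hu]; exact uniformizer_dvd_intCast hpε ⟨3 * m, by push_cast; ring⟩
  · rw [f4, e4]; exact uniformizer_dvd_intCast hpε (by rw [pow_one]; exact_mod_cast dvd_mul_right (3:ℤ) _)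
  · rw [f6, e6, hu]; exact uniformizer_dvd_intCast hpε ⟨-(3 * m), by push_cast; ring⟩
  · rw [WeierstrassCurve.map_b₂, eb₂, eq_intCast]
    exact uniformizer_dvd_intCast hpε (by rw [pow_one]; exact_mod_cast dvd_mul_right (3:ℤ) _)
  · rw [f6, e6, hu]; exact uniformizer_pow_dvd_intCast hpε ⟨-m, by push_cast; ring⟩
  · rw [WeierstrassCurve.map_b₈, eq_intCast]; exact uniformizer_pow_dvd_intCast hpε (by exact_mod_cast hb₈)
  · rw [WeierstrassCurve.map_b₆, eq_intCast]
    exact not_pow_succ_dvd_intCast Nat.prime_three hε hpε (n := 2) (by exact_mod_cast hb₆')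
      (by exact_mod_cast hb₆)

/-- **Cell `I₀*`: `b ≡ 1 (mod 3)`, `A₃ ≡ 1 (mod 9)`, `27 ∥ b³ − A₃` ⟹ type `I₀*`, `ord₃Δ_min = 6`** (Step 6
on the translate: with `b = 3k + 1`, `b³ − A₃ = 27g`, `u = 27(k²(k+1) − g)`, the cubic
`T³ − T² − kT − u/27` has discriminant `≡ g ≢ 0 (mod 3)`). [cite: SilvermanATAEC1994, IV.9.4 Step 6] -/
theorem kodairaSymbolAt_and_ord_nfQ_zero_Istar_zero (b A₃ : ℤ) (hA : A₃ % 3 = 1) (hb : b % 3 = 1)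
    (hM : (3 : ℤ) ^ 3 ∣ b ^ 3 - A₃) (hM' : ¬ (3 : ℤ) ^ (3 + 1) ∣ b ^ 3 - A₃) :
    (nfQ b A₃ 0).kodairaSymbolAt (Additive.placeOf 3) = .Istar 0 ∧
      (nfQ b A₃ 0).ordMinimalDiscriminant (Additive.placeOf 3) = 6 := by
  have hA3 := not_three_dvd_of_emod_one hA
  obtain ⟨e1, e2, e3, e4, e6, eb₂, eb₆, eb₈, eΔ⟩ := nfT_int_eqs b A₃
  obtain ⟨k, hk⟩ : ∃ k, b = 3 * k + 1 := ⟨b / 3, by omega⟩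
  obtain ⟨g, hg⟩ := hM
  have hgu : ¬ (3 : ℤ) ∣ g := fun ⟨c, hc⟩ ↦ hM' ⟨c, by rw [hg, hc]; ring⟩
  -- `u = 27 r`, `r = k²(k+1) − g`
  set r := k ^ 2 * (k + 1) - g with hr
  have hu : A₃ - 3 * b + 2 = 27 * r := by
    have e : A₃ - 3 * b + 2 = (b - 1) ^ 2 * (b + 2) - (b ^ 3 - A₃) := by ring
    rw [e, hg, hk, hr]; ring
  have eΔ' : (nfT b A₃ : WeierstrassCurve ℤ).Δ = 3 ^ 6 * (A₃ ^ 3 * g) := by rw [eΔ, hg]; ring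
  obtain ⟨hΔ, hΔ'⟩ := pexact_of_units 6 hA3 hgu
  rw [← eΔ'] at hΔ hΔ'
  refine kodairaSymbolAt_and_ord_nfQ_zero_of_nfT b A₃ (n := 6) (by norm_num) hΔ hΔ' ?_
  intro v' ε hε hpε
  haveI := perfectField_residueField_adicCompletionIntegers (K := ℚ) v'
  refine kodairaSymbolOfMinimal_intCast_eq_Istar_zero Nat.prime_three hε hpε ?_ ?_ ?_ ?_ ?_ ?_
  · rw [e1]; exact ⟨b, by push_cast; ring⟩
  · rw [e2]; exact ⟨-1, by norm_num⟩
  · rw [e3, hu]; exact ⟨3 * r, by push_cast; ring⟩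
  · rw [e4, hk]; exact ⟨-k, by push_cast; ring⟩
  · rw [e6, hu]; exact ⟨-r, by push_cast; ring⟩
  · -- the cubic `T³ − T² − kT − r` has discriminant `≡ g (mod 3)`
    rw [e2, e4, e6, hu, hk]
    have d2 : (-3 : ℤ) / ((3 : ℕ) : ℤ) ^ 1 = -1 := by norm_num
    have d4 : (3 : ℤ) * (1 - (3 * k + 1)) / ((3 : ℕ) : ℤ) ^ 2 = -k := by
      rw [show (3 : ℤ) * (1 - (3 * k + 1)) = 3 ^ 2 * (-k) by ring]
      push_cast; rw [Int.mul_ediv_cancel_left _ (by norm_num)]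
    have d6 : -((27 : ℤ) * r) / ((3 : ℕ) : ℤ) ^ 3 = -r := by
      rw [show -((27 : ℤ) * r) = 3 ^ 3 * (-r) by ring]
      push_cast; rw [Int.mul_ediv_cancel_left _ (by norm_num)]
    rw [d2, d4, d6, pow_one]
    have e : disc3 (-1) (-k) (-r) = 3 * (k ^ 3 - r - 9 * r ^ 2 - 6 * k * r) + g := by
      rw [disc3, hr]; ring
    rw [e]
    intro h
    have := (Int.dvd_add_right (Dvd.intro _ rfl)).mp (by exact_mod_cast h : (3 : ℤ) ∣ _)
    exact hgu this

end Summit.BirchSwinnertonDyer.Rank1Residual.O5.FlexNormalForm
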